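import Summits.Ventures.LatticeQCDFlow.Scaling.GroundStatePoincare
import Summits.Ventures.LatticeQCDFlow.Scaling.GroundStateShape

/-!
HONEST FRAMING: exact (Metropolis-corrected) sampling algorithms for lattice gauge theory; figures
of merit are autocorrelation/cost numbers at stated couplings and volumes; no continuum-physics
claim.

# UniversalPoincare — EVERY CONNECTED SWAP LIST: CHAINS OF AT MOST `K` LISTED PAIRS FROM THE HOT LEVEL EXIST (breadth-first growth from file 8's connectivity), CHAINS OF LENGTH `≤ L`
# GIVE THE POINCARÉ INEQUALITY `Σ_kv_k² ≤ 2(K+1)L²·Σ_r(v_{i_r} − v_{l_r})² + 2(K+1)·v_0²`, HENCE THE UNIVERSAL RATE FLOOR **`min{t/(2(K+1)K²m), h/(2(K+1))} ≤ ρ`** AND THE UNIVERSAL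
# SHAPE BOUND `c_k ≤ (1 + K·mh/t)·c_0` (lean-2 GEN-48, ours)

Venture-side (OURS).  Cell `lqcd-flow` (pub-lqcd), unit `pub-lqcd-lean-2-g48`, 2026-08-31.  Chapter AI (the sizes of the Robin ground state), file 7 — Mathlib only (through files 2, 3).
(§1) CHAIN EXTENSION and BREADTH-FIRST GROWTH: from chapter AH file 8's connectivity hypothesis (every non-empty proper set of levels is left by a listed pair) the set of levels joined
to `0` by a chain of `≤ n` listed pairs has at least `n+1` elements or is everything; so every level is within `K` pairs of the hot one (`connected_reachable`).  (§2) THE CHAIN POINCARÉ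
INEQUALITY (crude congestion): along a chain of `n ≤ L` pairs `(v_k − v_0)² ≤ n·Σ_j(Δ_jv)² ≤ L²·Σ_r(v_{i_r} − v_{l_r})²` (each step is one listed pair), so `Σ_kv_k² ≤ 2(K+1)L²·Σ_r(…)² +
2(K+1)v_0²`; file 3 turns it into `min{t/(2(K+1)L²m), h/(2(K+1))} ≤ ρ`.  (§3) UNIVERSAL COROLLARIES for a positive solution on ANY connected list (`m ≥ 1`, `t, h > 0`):
**`min{t/(2(K+1)K²m), h/(2(K+1))} ≤ ρ ≤ h/(K+1)`** and **`c_k ≤ (1 + K·mh/t)·c_0`** (file 2's chain bound) — the Robin ground state of every connected exchange topology relaxes in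
polynomially many steps, `1/ρ ≤ 2(K+1)·max{K²m/t, 1/h}`; the dedicated Poincaré inequalities of file 3 (path `K²(K+1)/t`, hub-adjacent `2m/t`) are the sharp instances.  No definitions;
no Markov chain in this file (file 8 reads the ceiling `⌈(1/ρ)·log(4h/ρ)⌉` off it).

* §1 `chain_snoc`, `connected_reachable_step`, `connected_reachable`, `connected_of_reachable` (conversely, chains give connectivity); §2 `chain_sub_sq_le`, `chain_poincare`, `chain_rho_ge`; §3 `connected_rho_ge`, `connected_le_hot_mul`.

Literature grade (cell rule): ELEMENTARY (breadth-first search; canonical paths with crude congestion), NEW TYPING; nothing cited; no new bib keys.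
-/

noncomputable section

open Finset

namespace Summit.Ventures.LatticeQCDFlow.Scaling

section Universal
variable {K m : ℕ} (e : Fin m → Fin (K + 1) × Fin (K + 1)) {t h ρ : ℝ} {c : Fin (K + 1) → ℝ}

/-! ## §1 Chains exist on a connected list -/

/-- **Chain extension:** a chain `γ` of `n` listed pairs from `0` to `a` and a listed pair `{a, b}` give a chain of `n+1` listed pairs from `0` to `b` (`Fin.snoc`). [ours] -/
theorem chain_snoc {n : ℕ} {γ : Fin (n + 1) → Fin (K + 1)} {a b : Fin (K + 1)} (hγ0 : γ 0 = 0) (hγa : γ (Fin.last n) = a)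
    (hγ : ∀ j : Fin n, ∃ r : Fin m, ((e r).1 = γ j.castSucc ∧ (e r).2 = γ j.succ) ∨ ((e r).1 = γ j.succ ∧ (e r).2 = γ j.castSucc))
    (hab : ∃ r : Fin m, ((e r).1 = a ∧ (e r).2 = b) ∨ ((e r).1 = b ∧ (e r).2 = a)) :
    ∃ γ' : Fin (n + 2) → Fin (K + 1), γ' 0 = 0 ∧ γ' (Fin.last (n + 1)) = b ∧
      ∀ j : Fin (n + 1), ∃ r : Fin m, ((e r).1 = γ' j.castSucc ∧ (e r).2 = γ' j.succ) ∨ ((e r).1 = γ' j.succ ∧ (e r).2 = γ' j.castSucc) := by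
  refine ⟨Fin.snoc γ b, ?_, ?_, ?_⟩
  · have : (0 : Fin (n + 2)) = (0 : Fin (n + 1)).castSucc := rfl
    rw [this, Fin.snoc_castSucc, hγ0]
  · rw [Fin.snoc_last]
  · intro j
    rcases Fin.eq_castSucc_or_eq_last j with ⟨j', hj'⟩ | hj
    · rw [hj', Fin.snoc_castSucc, Fin.succ_castSucc, Fin.snoc_castSucc]
      exact hγ j'
    · rw [hj, Fin.snoc_castSucc, Fin.succ_last, Fin.snoc_last, hγa]
      exact hab

/-- **Breadth-first growth:** on a connected list, for every `n` there is a set of levels containing `0`, each joined to `0` by a chain of at most `n` listed pairs, with at least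
`n+1` elements unless it is everything. [ours] -/
theorem connected_reachable_step
    (hconn : ∀ A : Finset (Fin (K + 1)), A.Nonempty → A ≠ univ → ∃ r : Fin m, ((e r).1 ∈ A ∧ (e r).2 ∉ A) ∨ ((e r).2 ∈ A ∧ (e r).1 ∉ A)) (n : ℕ) :
    ∃ R : Finset (Fin (K + 1)), (0 : Fin (K + 1)) ∈ R ∧ (n + 1 ≤ R.card ∨ R = univ) ∧
      ∀ k ∈ R, ∃ n' : ℕ, n' ≤ n ∧ ∃ γ : Fin (n' + 1) → Fin (K + 1), γ 0 = 0 ∧ γ (Fin.last n') = k ∧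
        ∀ j : Fin n', ∃ r : Fin m, ((e r).1 = γ j.castSucc ∧ (e r).2 = γ j.succ) ∨ ((e r).1 = γ j.succ ∧ (e r).2 = γ j.castSucc) := by
  induction n with
  | zero =>
    refine ⟨{0}, mem_singleton_self _, Or.inl (by simp), fun k hk => ?_⟩
    rw [mem_singleton] at hk
    exact ⟨0, le_rfl, fun _ => 0, rfl, by rw [hk], fun j => Fin.elim0 j⟩
  | succ n ih =>
    obtain ⟨R, h0R, hcard, hch⟩ := ih
    by_cases hRu : R = univ
    · refine ⟨R, h0R, Or.inr hRu, fun k hk => ?_⟩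
      obtain ⟨n', hn', γ, hγ⟩ := hch k hk
      exact ⟨n', by omega, γ, hγ⟩
    · obtain ⟨r, hr⟩ := hconn R ⟨0, h0R⟩ hRu
      -- the new level `b ∉ R` attached to `a ∈ R`
      have hab : ∃ a b : Fin (K + 1), a ∈ R ∧ b ∉ R ∧ (((e r).1 = a ∧ (e r).2 = b) ∨ ((e r).1 = b ∧ (e r).2 = a)) := by
        rcases hr with ⟨h1, h2⟩ | ⟨h2, h1⟩
        · exact ⟨(e r).1, (e r).2, h1, h2, Or.inl ⟨rfl, rfl⟩⟩
        · exact ⟨(e r).2, (e r).1, h2, h1, Or.inr ⟨rfl, rfl⟩⟩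
      obtain ⟨a, b, haR, hbR, hpair⟩ := hab
      refine ⟨insert b R, mem_insert_of_mem h0R, ?_, fun k hk => ?_⟩
      · rcases hcard with hc | hc
        · left; rw [card_insert_of_notMem hbR]; omega
        · exact absurd hc hRu
      · rw [mem_insert] at hk
        rcases hk with hkb | hkR
        · -- extend `a`'s chain by the pair `{a, b}`
          obtain ⟨n', hn', γ, hγ0, hγa, hγ⟩ := hch a haR
          obtain ⟨γ', hγ'0, hγ'b, hγ'⟩ := chain_snoc e hγ0 hγa hγ ⟨r, hpair⟩
          exact ⟨n' + 1, by omega, γ', hγ'0, by rw [hkb]; exact hγ'b, hγ'⟩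
        · obtain ⟨n', hn', γ, hγ⟩ := hch k hkR
          exact ⟨n', by omega, γ, hγ⟩

/-- **EVERY LEVEL OF A CONNECTED LIST IS WITHIN `K` LISTED PAIRS OF THE HOT ONE.** [ours] -/
theorem connected_reachable
    (hconn : ∀ A : Finset (Fin (K + 1)), A.Nonempty → A ≠ univ → ∃ r : Fin m, ((e r).1 ∈ A ∧ (e r).2 ∉ A) ∨ ((e r).2 ∈ A ∧ (e r).1 ∉ A)) (k : Fin (K + 1)) :
    ∃ n : ℕ, n ≤ K ∧ ∃ γ : Fin (n + 1) → Fin (K + 1), γ 0 = 0 ∧ γ (Fin.last n) = k ∧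
      ∀ j : Fin n, ∃ r : Fin m, ((e r).1 = γ j.castSucc ∧ (e r).2 = γ j.succ) ∨ ((e r).1 = γ j.succ ∧ (e r).2 = γ j.castSucc) := by
  obtain ⟨R, _, hcard, hch⟩ := connected_reachable_step e hconn K
  have hRu : R = univ := by
    rcases hcard with hc | hc
    · apply eq_univ_of_card
      refine le_antisymm (card_le_univ R) ?_
      rw [Fintype.card_fin]; exact hc
    · exact hc
  exact hch k (by rw [hRu]; exact mem_univ k)

/-- **Chains from the hot level give connectivity:** if every level is joined to `0` by a chain of listed pairs, every non-empty proper set of levels is crossed by a listed pair. [ours] -/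
theorem connected_of_reachable {L : ℕ}
    (hreach : ∀ k : Fin (K + 1), ∃ n : ℕ, n ≤ L ∧ ∃ γ : Fin (n + 1) → Fin (K + 1), γ 0 = 0 ∧ γ (Fin.last n) = k ∧
      ∀ j : Fin n, ∃ r : Fin m, ((e r).1 = γ j.castSucc ∧ (e r).2 = γ j.succ) ∨ ((e r).1 = γ j.succ ∧ (e r).2 = γ j.castSucc))
    (A : Finset (Fin (K + 1))) (hA : A.Nonempty) (hAu : A ≠ univ) :
    ∃ r : Fin m, ((e r).1 ∈ A ∧ (e r).2 ∉ A) ∨ ((e r).2 ∈ A ∧ (e r).1 ∉ A) := by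
  -- a level whose membership differs from the hot level's
  have hk : ∃ k : Fin (K + 1), ¬(k ∈ A ↔ (0 : Fin (K + 1)) ∈ A) := by
    by_contra hall
    push Not at hall
    by_cases h0 : (0 : Fin (K + 1)) ∈ A
    · exact hAu (eq_univ_of_forall fun k => (hall k).mpr h0)
    · obtain ⟨a, ha⟩ := hA; exact h0 ((hall a).mp ha)
  obtain ⟨k, hk⟩ := hk
  obtain ⟨n, _, γ, hγ0, hγk, hγ⟩ := hreach k
  -- along the chain membership must change somewhere
  by_contra hno
  push Not at hno
  have hconst : ∀ i : Fin (n + 1), (γ i ∈ A ↔ (0 : Fin (K + 1)) ∈ A) := by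
    intro i
    induction i using Fin.induction with
    | zero => rw [hγ0]
    | succ j ih =>
      obtain ⟨r, hr⟩ := hγ j
      have h1 := (hno r).1
      have h2 := (hno r).2
      rcases hr with ⟨ha, hb⟩ | ⟨ha, hb⟩
      · rw [ha, hb] at h1 h2
        constructor
        · intro hs; exact ih.mp (h2 hs)
        · intro h0; exact h1 (ih.mpr h0)
      · rw [ha, hb] at h1 h2
        constructor
        · intro hs; exact ih.mp (h1 hs)
        · intro h0; exact h2 (ih.mpr h0)
  exact hk (hγk ▸ hconst (Fin.last n))


/-! ## §2 The chain Poincaré inequality -/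

/-- **Along a chain of `n` listed pairs: `(v_{γ_n} − v_0)² ≤ n²·Σ_r(v_{i_r} − v_{l_r})²`** (each step is one listed pair; crude congestion). [ours] -/
theorem chain_sub_sq_le {n : ℕ} {γ : Fin (n + 1) → Fin (K + 1)} (hγ0 : γ 0 = 0)
    (hγ : ∀ j : Fin n, ∃ r : Fin m, ((e r).1 = γ j.castSucc ∧ (e r).2 = γ j.succ) ∨ ((e r).1 = γ j.succ ∧ (e r).2 = γ j.castSucc)) (v : Fin (K + 1) → ℝ) :
    (v (γ (Fin.last n)) - v 0) ^ 2 ≤ (n : ℝ) ^ 2 * ∑ r : Fin m, (v (e r).1 - v (e r).2) ^ 2 := by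
  set X : ℝ := ∑ r : Fin m, (v (e r).1 - v (e r).2) ^ 2 with hX
  have hX0 : 0 ≤ X := sum_nonneg fun r _ => sq_nonneg _
  -- telescoping along the chain (ℕ-indexed copy of `v ∘ γ`)
  set f : ℕ → ℝ := fun i => if hi : i < n + 1 then v (γ ⟨i, hi⟩) else 0 with hf
  have hf0 : f 0 = v 0 := by rw [hf]; simp only [Nat.zero_lt_succ, dif_pos]; rw [show (⟨0, Nat.zero_lt_succ n⟩ : Fin (n + 1)) = 0 from rfl, hγ0]
  have hfn : f n = v (γ (Fin.last n)) := by rw [hf]; simp only [Nat.lt_succ_self, dif_pos]; rfl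
  have htel : ∑ i ∈ range n, (f (i + 1) - f i) = f n - f 0 := sum_range_sub f n
  -- each step is a listed pair
  have hstep : ∀ i ∈ range n, (f (i + 1) - f i) ^ 2 ≤ X := by
    intro i hi
    rw [mem_range] at hi
    set j : Fin n := ⟨i, hi⟩ with hj
    have h1 : f (i + 1) = v (γ j.succ) := by
      rw [hf]; simp only [show i + 1 < n + 1 by omega, dif_pos]; rfl
    have h2 : f i = v (γ j.castSucc) := by
      rw [hf]; simp only [show i < n + 1 by omega, dif_pos]; rfl
    rw [h1, h2]
    obtain ⟨r, hr⟩ := hγ j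
    have : (v (γ j.succ) - v (γ j.castSucc)) ^ 2 = (v (e r).1 - v (e r).2) ^ 2 := by
      rcases hr with ⟨ha, hb⟩ | ⟨ha, hb⟩
      · rw [ha, hb]; ring
      · rw [ha, hb]
    rw [this]
    exact Finset.single_le_sum (fun r _ => sq_nonneg (v (e r).1 - v (e r).2)) (mem_univ r)
  have hcs : (∑ i ∈ range n, (f (i + 1) - f i)) ^ 2 ≤ (n : ℝ) * ∑ i ∈ range n, (f (i + 1) - f i) ^ 2 := by
    have := sq_sum_le_card_mul_sum_sq (s := range n) (f := fun i => f (i + 1) - f i)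
    rw [card_range] at this
    exact_mod_cast this
  have hsum : ∑ i ∈ range n, (f (i + 1) - f i) ^ 2 ≤ (n : ℝ) * X := by
    calc ∑ i ∈ range n, (f (i + 1) - f i) ^ 2 ≤ ∑ _i ∈ range n, X := sum_le_sum hstep
      _ = (n : ℝ) * X := by rw [sum_const, card_range, nsmul_eq_mul]
  rw [← hfn, ← hf0, ← htel]
  have hn0 : (0 : ℝ) ≤ n := Nat.cast_nonneg n
  calc (∑ i ∈ range n, (f (i + 1) - f i)) ^ 2 ≤ (n : ℝ) * ∑ i ∈ range n, (f (i + 1) - f i) ^ 2 := hcs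
    _ ≤ (n : ℝ) * ((n : ℝ) * X) := mul_le_mul_of_nonneg_left hsum hn0
    _ = (n : ℝ) ^ 2 * X := by ring

/-- **THE CHAIN POINCARÉ INEQUALITY:** every level within `L` listed pairs of the hot one ⇒ `Σ_kv_k² ≤ 2(K+1)L²·Σ_r(v_{i_r} − v_{l_r})² + 2(K+1)·v_0²`. [ours] -/
theorem chain_poincare (L : ℕ)
    (hreach : ∀ k : Fin (K + 1), ∃ n : ℕ, n ≤ L ∧ ∃ γ : Fin (n + 1) → Fin (K + 1), γ 0 = 0 ∧ γ (Fin.last n) = k ∧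
      ∀ j : Fin n, ∃ r : Fin m, ((e r).1 = γ j.castSucc ∧ (e r).2 = γ j.succ) ∨ ((e r).1 = γ j.succ ∧ (e r).2 = γ j.castSucc)) (v : Fin (K + 1) → ℝ) :
    ∑ k : Fin (K + 1), v k ^ 2 ≤ 2 * ((K : ℝ) + 1) * (L : ℝ) ^ 2 * ∑ r : Fin m, (v (e r).1 - v (e r).2) ^ 2 + 2 * ((K : ℝ) + 1) * v 0 ^ 2 := by
  set X : ℝ := ∑ r : Fin m, (v (e r).1 - v (e r).2) ^ 2 with hX
  have hX0 : 0 ≤ X := sum_nonneg fun r _ => sq_nonneg _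
  have hpt : ∀ k : Fin (K + 1), v k ^ 2 ≤ 2 * (L : ℝ) ^ 2 * X + 2 * v 0 ^ 2 := by
    intro k
    obtain ⟨n, hnL, γ, hγ0, hγk, hγ⟩ := hreach k
    have h1 := chain_sub_sq_le e hγ0 hγ v
    rw [hγk] at h1
    have hnL' : (n : ℝ) ^ 2 ≤ (L : ℝ) ^ 2 := by
      have : (n : ℝ) ≤ L := Nat.cast_le.mpr hnL
      exact pow_le_pow_left₀ (Nat.cast_nonneg n) this 2
    have h2 : (v k - v 0) ^ 2 ≤ (L : ℝ) ^ 2 * X := le_trans h1 (mul_le_mul_of_nonneg_right hnL' hX0)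
    nlinarith [sq_nonneg (v k - 2 * v 0)]
  calc ∑ k : Fin (K + 1), v k ^ 2 ≤ ∑ _k : Fin (K + 1), (2 * (L : ℝ) ^ 2 * X + 2 * v 0 ^ 2) := sum_le_sum fun k _ => hpt k
    _ = ((K : ℝ) + 1) * (2 * (L : ℝ) ^ 2 * X + 2 * v 0 ^ 2) := by
        rw [sum_const, card_univ, Fintype.card_fin, nsmul_eq_mul]; push_cast; ring
    _ = 2 * ((K : ℝ) + 1) * (L : ℝ) ^ 2 * X + 2 * ((K : ℝ) + 1) * v 0 ^ 2 := by ring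

/-- **THE CHAIN RATE FLOOR: `min{t/(2(K+1)L²m), h/(2(K+1))} ≤ ρ`** for a positive solution when every level is within `L ≥ 1` listed pairs of the hot one (`m ≥ 1`, `t, h > 0`). [ours] -/
theorem chain_rho_ge (hm : 1 ≤ m) (ht : 0 < t) (hh : 0 < h) (hc : ∀ k, 0 < c k)
    (hvertex : ∀ k : Fin (K + 1), t / m * ∑ r : Fin m, ((if k = (e r).1 then c (e r).2 - c (e r).1 else 0) + (if k = (e r).2 then c (e r).1 - c (e r).2 else 0))
      - (if k = 0 then h * c k else 0) = -ρ * c k) {L : ℕ} (hL : 1 ≤ L)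
    (hreach : ∀ k : Fin (K + 1), ∃ n : ℕ, n ≤ L ∧ ∃ γ : Fin (n + 1) → Fin (K + 1), γ 0 = 0 ∧ γ (Fin.last n) = k ∧
      ∀ j : Fin n, ∃ r : Fin m, ((e r).1 = γ j.castSucc ∧ (e r).2 = γ j.succ) ∨ ((e r).1 = γ j.succ ∧ (e r).2 = γ j.castSucc)) :
    min (t / (2 * ((K : ℝ) + 1) * (L : ℝ) ^ 2 * m)) (h / (2 * ((K : ℝ) + 1))) ≤ ρ := by
  have hLpos : (0 : ℝ) < L := Nat.cast_pos.mpr (by omega)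
  exact groundState_rho_ge_min e hm ht hh hc hvertex (a := 2 * ((K : ℝ) + 1) * (L : ℝ) ^ 2) (b := 2 * ((K : ℝ) + 1)) (by positivity) (by positivity)
    (chain_poincare e L hreach)

/-! ## §3 Universal corollaries on a connected list -/

/-- **THE UNIVERSAL RATE WINDOW ON A CONNECTED LIST: `min{t/(2(K+1)K²m), h/(2(K+1))} ≤ ρ ≤ h/(K+1)`** for a positive solution (`m ≥ 1`, `t, h > 0`, `K ≥ 1`). [ours] -/
theorem connected_rho_ge (hm : 1 ≤ m) (hK : 1 ≤ K) (ht : 0 < t) (hh : 0 < h)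
    (hconn : ∀ A : Finset (Fin (K + 1)), A.Nonempty → A ≠ univ → ∃ r : Fin m, ((e r).1 ∈ A ∧ (e r).2 ∉ A) ∨ ((e r).2 ∈ A ∧ (e r).1 ∉ A))
    (hc : ∀ k, 0 < c k)
    (hvertex : ∀ k : Fin (K + 1), t / m * ∑ r : Fin m, ((if k = (e r).1 then c (e r).2 - c (e r).1 else 0) + (if k = (e r).2 then c (e r).1 - c (e r).2 else 0))
      - (if k = 0 then h * c k else 0) = -ρ * c k) :
    min (t / (2 * ((K : ℝ) + 1) * (K : ℝ) ^ 2 * m)) (h / (2 * ((K : ℝ) + 1))) ≤ ρ ∧ ρ * ((K : ℝ) + 1) ≤ h :=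
  ⟨chain_rho_ge e hm ht hh hc hvertex hK (connected_reachable e hconn), groundState_rho_le_hot e hc ht.le hvertex⟩

/-- **THE UNIVERSAL SHAPE BOUND ON A CONNECTED LIST: `c_k ≤ (1 + K·mh/t)·c_0`** for a positive solution with `ρ > 0` (`m ≥ 1`, `t > 0`). [ours] -/
theorem connected_le_hot_mul (hm : 1 ≤ m) (ht : 0 < t) (hρ : 0 < ρ)
    (hconn : ∀ A : Finset (Fin (K + 1)), A.Nonempty → A ≠ univ → ∃ r : Fin m, ((e r).1 ∈ A ∧ (e r).2 ∉ A) ∨ ((e r).2 ∈ A ∧ (e r).1 ∉ A))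
    (hc : ∀ k, 0 < c k)
    (hvertex : ∀ k : Fin (K + 1), t / m * ∑ r : Fin m, ((if k = (e r).1 then c (e r).2 - c (e r).1 else 0) + (if k = (e r).2 then c (e r).1 - c (e r).2 else 0))
      - (if k = 0 then h * c k else 0) = -ρ * c k) (k : Fin (K + 1)) :
    c k ≤ (1 + (K : ℝ) * (m * h / t)) * c 0 :=
  groundState_le_of_reachable e hm ht hρ hc hvertex K (connected_reachable e hconn) k

end Universal

end Summit.Ventures.LatticeQCDFlow.Scaling

end
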